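import Summits.QuantumFields.YangMills.Theorems.BalabanUVNodesK2Line1PrimeRemainderPrice

/-!
# CRIT-2 (g2) — re-pricing probe of the idea-5 ∕ idea-6 ∕ idea-7 verdicts against K2⁷ SKELETON v3
(`run/shared/lean/pub/pub-ymgap/pub-ymgap-plan/D80-K2V3/K2Skeleton13SepCoPHv3.lean`, sha256 bdd723a0…; registered 2026-08-28T00:31:22Z)
and the landed price ∕ definition files p588621 (`BalabanUVNodesK2JsOfRecord`), p587749 (`…K2Line2SlopeGuardPrice`), p590583 (`…K2Line1PrimeRemainderPrice`).

Crux of record: K2⁷ = `stmt-QuantumFields-20543` = `Summit.QuantumFields.YangMills.Theses.BalabanUVNodes.EndpointGivenBR13SepCoPH` (OPEN).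

HONEST FRAMING.  Nothing here proves an estimate of Bałaban's; every theorem is bookkeeping between hypothesis SHAPES (kernel-checked, no `sorry`).
The Clay YM mass gap is NOT proved by any of this; route R4 closes only the conditional finite-𝕋⁴ rung `BalabanLadder.UV`; [I] = [Balaban1987RG1] Thm 2 ∕ (0.31)
p. 259 (NODE O) is UNPROVED in print; K2⁷ stays OPEN.

WHAT IS CHECKED (shapes re-spelled verbatim because the registered skeleton and the idea sketches are not importable by design):
* §1 generic: `S.β1 = β − S.β0` for every `OneLoopSplit`; idea-7's `AnchorVanishing S` ⟺ an4's per-scale anchor of `β` at `S.β0`; idea-5's (AF-1) linear bound on `S.β1`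
  ⟺ DEF-1's `BoxRemainder β S.β0`; the seam `C·γ ≤ s` is FREE for the linear and for the MODULUS grade (shrink the box); a modulus grade gives the constant form + the anchor.
* §2 structural: EVERY one-loop split of a β of record `betaOfMerged βm β0 γ` has one-loop numbers `β0` — at NODE 00's Stage-13 record this is `beta0OfMerged … θ.v₀`
  (the `θ.v₀`-path `limUnder`), for every split (line 2 cannot be re-referenced by choosing another split).
* §3 at the record: idea-5's `AF1AtRecord13` body ⟺ v3 stub 2′'s `BoxRemainder` conjunct AT THE RECORD's `beta0OfMerged … θ.v₀` numbers; at the NAMED numbers `beta0OfJs F κ`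
  (AF-1) + (C) + (U) ⟹ `RemAt F κ θ hP` with NO numeral seam, and the modulus grade ⟹ an4's constant-form package `RemAtC`; idea-7's S2 (`D4AnchorRecord13` at θ) under
  stub 2′ at (κ, θ) ⟺ THE IDENTIFICATION `beta0OfMerged … θ.v₀ = beta0OfJs F κ`; the named-numbers anchor S2′ is FREE given stub 2′; and {`stub_anchor13`, `stub_remNamedJets13`}
  ⊢ that identification at EVERY admissible tuple, `θ.v₀` unconstrained (CRIT-1's data anomaly, F1a: `Admissible` is blind to `v₀`).
-/

noncomputable section

open scoped Matrix.Norms.L2Operator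

namespace Summit.QuantumFields.YangMills.Cruxes.EndpointGivenBR13SepCoPH.Crit2RepriceV3

open Literature.MathematicalPhysics.QuantumFieldTheory.Balaban1983to89
open Literature.MathematicalPhysics.QuantumFieldTheory.Balaban1983to89.FlowStep
open Literature.MathematicalPhysics.QuantumFieldTheory.Balaban1983to89.B12Beta (HistBox OneLoopSplit)
open Literature.MathematicalPhysics.QuantumFieldTheory.Balaban1983to89.T4Continuum (T4Family)
open Literature.MathematicalPhysics.QuantumFieldTheory.Balaban1983to89.Node00
open Summit.QuantumFields.YangMills.Theorems.BalabanUVNodesK2JsOfRecord (StepColourData JsOfRecord beta0OfJs BoxRemainder stepBal_L_pos)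
open Summit.QuantumFields.YangMills.Theorems.BalabanUVNodesK2Line1PrimeRemainderPrice (eq_of_anchors anchor_of_boxRemainder)

/-! ## §0 Shapes (re-spelled) -/

/-- an4's per-scale anchor of `β` at the reference numbers `b` (`HistBox`-spelled; the second conjunct-shape of `RemAtC`). -/
def Anchor (β : HBeta) (b : ℕ → ℝ) : Prop :=
  ∀ (k : ℕ) (δ : ℝ), 0 < δ → ∃ γ : ℝ, 0 < γ ∧ ∀ p : Fin (k + 1) → ℝ, p ∈ HistBox γ k → |β k p - b k| ≤ δ

/-- idea-7's ∕ skeleton v3 :233 `AnchorVanishing` (VERBATIM). -/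
def AnchorVanishing {β : HBeta} (S : OneLoopSplit β) : Prop :=
  ∀ k : ℕ, ∀ δ : ℝ, 0 < δ → ∃ γ : ℝ, 0 < γ ∧ ∀ v ∈ Box γ k, |S.β1 k v| ≤ δ

/-- a modulus of continuity at `0⁺`: `ω(t) → 0` as `t → 0⁺` (ε–δ form). -/
def VanishesAtZero (ω : ℝ → ℝ) : Prop :=
  ∀ ε : ℝ, 0 < ε → ∃ δ : ℝ, 0 < δ ∧ ∀ t : ℝ, 0 < t → t ≤ δ → ω t ≤ ε

/-- MODULUS-form box remainder `|β_{k+1}(p) − b_k| ≤ ω(p_k)` on `]0,γ₀]`-histories (idea-5's natural grade, e.g. `ω(g) = C·g·log⁶(1∕g)`; `ω(t) = C·t` is DEF-1's `BoxRemainder`). -/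
def BoxModulus (β : HBeta) (b : ℕ → ℝ) (ω : ℝ → ℝ) (γ₀ : ℝ) : Prop :=
  ∀ (k : ℕ) (p : Fin (k + 1) → ℝ), p ∈ HistBox γ₀ k → |β k p - b k| ≤ ω (p (Fin.last k))

/-- skeleton v3 :172 `RemAt` (VERBATIM): line 1′'s shared letter — stub 2′ `stub_remNamedJets13 : ∀ F, ∃ κ, ∀ θ hP, θ.Admissible F 2 → RemAt F κ θ hP`. -/
def RemAt (F : T4Family) (κ : StepColourData) (θ : Node00.Stage13HParams F 2) (hP : θ.Provisos₁₃SepCoPH F 2) : Prop :=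
  ∃ γ₀ Cr β' : ℝ, 0 < γ₀ ∧ γ₀ ≤ θ.γ ∧ 0 ≤ Cr ∧ 0 ≤ β' ∧
    BoxRemainder (Node00.datumOfRecord₁₃SepCoPH F 2 θ hP).βfun (beta0OfJs F κ) Cr γ₀ ∧
    Cr * γ₀ ≤ B12Normalization.stepBal 2 F.L ∧
    BetaContH γ₀ (Node00.datumOfRecord₁₃SepCoPH F 2 θ hP).βfun ∧
    BetaUpperH β' γ₀ (Node00.datumOfRecord₁₃SepCoPH F 2 θ hP).βfun

/-- skeleton v3 :181 `RemAtSomeJets` (VERBATIM): the TEXT of `stub_remNamedJets13`. -/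
def RemAtSomeJets : Prop :=
  ∀ F : T4Family, ∃ κ : StepColourData,
    ∀ (θ : Node00.Stage13HParams F 2) (hP : θ.Provisos₁₃SepCoPH F 2), θ.Admissible F 2 → RemAt F κ θ hP

/-- skeleton v3 :417 `D4AnchorRecord13` (VERBATIM): the TEXT of `stub_anchor13` (idea-7's S2). -/
def D4AnchorRecord13 : Prop :=
  ∀ (F : T4Family) (θ : Node00.Stage13HParams F 2) (hP : θ.Provisos₁₃SepCoPH F 2), θ.Admissible F 2 →
    letI := θ.instVβ₁; letI := θ.instVβ₂; letI := θ.instιβ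
    AnchorVanishing
      (oneLoopSplit_betaOfMerged (betaMerged F (mergedTermFamilyMatT F 2 (TcanOfRecord F 2) (chiFixed29 F 2 θ.ν θ.ε₂₉) θ.εbg) θ.ρ8 θ.bV)
        (beta0OfMerged (betaMerged F (mergedTermFamilyMatT F 2 (TcanOfRecord F 2) (chiFixed29 F 2 θ.ν θ.ε₂₉) θ.εbg) θ.ρ8 θ.bV) θ.v₀) θ.γ)

/-! ## §1 Generic bookkeeping (no record, no estimate) -/

section Generic

variable {β : HBeta} {b b' : ℕ → ℝ}

/-- the remainder of a one-loop split IS `β − β⁰`. [folklore] -/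
theorem split_β1_eq (S : OneLoopSplit β) (k : ℕ) (p : Fin (k + 1) → ℝ) : S.β1 k p = β k p - S.β0 k := by
  rw [S.split k p]; ring

/-- idea-7's `AnchorVanishing S` ⟺ an4's per-scale anchor of `β` at the split's numbers `S.β0`. [folklore] -/
theorem anchorVanishing_iff_anchor (S : OneLoopSplit β) : AnchorVanishing S ↔ Anchor β S.β0 := by
  constructor
  · intro h k δ hδ
    obtain ⟨γ, hγ, hb⟩ := h k δ hδ
    refine ⟨γ, hγ, fun p hp => ?_⟩
    rw [← split_β1_eq S]
    exact hb p (by rwa [histBox_eq_box] at hp)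
  · intro h k δ hδ
    obtain ⟨γ, hγ, hb⟩ := h k δ hδ
    refine ⟨γ, hγ, fun v hv => ?_⟩
    rw [split_β1_eq S]
    exact hb v (by rwa [histBox_eq_box])

/-- idea-5's (AF-1) linear bound on `S.β1` ⟺ DEF-1's `BoxRemainder β S.β0` (same constant, same box). [folklore] -/
theorem af1_iff_boxRemainder (S : OneLoopSplit β) (C γ₀ : ℝ) :
    (∀ (k : ℕ) (p : Fin (k + 1) → ℝ), p ∈ HistBox γ₀ k → |S.β1 k p| ≤ C * p (Fin.last k)) ↔ BoxRemainder β S.β0 C γ₀ := by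
  simp only [BoxRemainder, split_β1_eq S]

/-- under a box remainder at `b`, an anchor at `b′` IS the identification `b′ = b` (an4's `eq_of_anchors` ∕ `anchor_of_boxRemainder`). [folklore] -/
theorem anchor_iff_eq_of_boxRemainder {C γ₀ : ℝ} (h : BoxRemainder β b C γ₀) (hC : 0 ≤ C) (hγ₀ : 0 < γ₀) : Anchor β b' ↔ b' = b :=
  ⟨fun h' => eq_of_anchors h' (anchor_of_boxRemainder h hC hγ₀), fun e => by rw [e]; exact anchor_of_boxRemainder h hC hγ₀⟩

/-- THE SEAM IS FREE FOR THE LINEAR FORM: shrink the box to `]0, min γ₀ (s∕(C+1))]`. [folklore] -/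
theorem boxRemainder_seam_free {C γ₀ s : ℝ} (h : BoxRemainder β b C γ₀) (hC : 0 ≤ C) (hγ₀ : 0 < γ₀) (hs : 0 < s) :
    ∃ γ₁ : ℝ, 0 < γ₁ ∧ γ₁ ≤ γ₀ ∧ BoxRemainder β b C γ₁ ∧ C * γ₁ ≤ s := by
  have hC1 : 0 < C + 1 := by linarith
  refine ⟨min γ₀ (s / (C + 1)), lt_min hγ₀ (by positivity), min_le_left _ _, h.mono (min_le_left _ _), ?_⟩
  calc C * min γ₀ (s / (C + 1)) ≤ C * (s / (C + 1)) := mul_le_mul_of_nonneg_left (min_le_right _ _) hC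
    _ ≤ (C + 1) * (s / (C + 1)) := mul_le_mul_of_nonneg_right (by linarith) (by positivity)
    _ = s := by field_simp

/-- the linear form is the modulus form with `ω(t) = C·t`. [folklore] -/
theorem boxModulus_of_boxRemainder {C γ₀ : ℝ} (h : BoxRemainder β b C γ₀) : BoxModulus β b (fun t => C * t) γ₀ := h

/-- `C·t → 0`. [folklore] -/
theorem vanishesAtZero_linear {C : ℝ} (hC : 0 ≤ C) : VanishesAtZero (fun t => C * t) := by
  intro ε hε
  have hC1 : 0 < C + 1 := by linarith
  refine ⟨ε / (C + 1), by positivity, fun t _ ht => ?_⟩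
  calc C * t ≤ C * (ε / (C + 1)) := mul_le_mul_of_nonneg_left ht hC
    _ ≤ (C + 1) * (ε / (C + 1)) := mul_le_mul_of_nonneg_right (by linarith) (by positivity)
    _ = ε := by field_simp

/-- THE SEAM IS FREE FOR THE MODULUS GRADE TOO: any `s > 0` bounds the remainder on a small enough box. [folklore] -/
theorem const_of_boxModulus {ω : ℝ → ℝ} {γ₀ : ℝ} (h : BoxModulus β b ω γ₀) (hω : VanishesAtZero ω) (hγ₀ : 0 < γ₀) {s : ℝ} (hs : 0 < s) :
    ∃ γ₁ : ℝ, 0 < γ₁ ∧ γ₁ ≤ γ₀ ∧ ∀ (k : ℕ) (p : Fin (k + 1) → ℝ), p ∈ HistBox γ₁ k → |β k p - b k| ≤ s := by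
  obtain ⟨δ, hδ, hωδ⟩ := hω s hs
  refine ⟨min γ₀ δ, lt_min hγ₀ hδ, min_le_left _ _, fun k p hp => ?_⟩
  have hp₀ : p ∈ HistBox γ₀ k := fun i => ⟨(hp i).1, (hp i).2.trans (min_le_left _ _)⟩
  exact (h k p hp₀).trans (hωδ _ (hp (Fin.last k)).1 ((hp (Fin.last k)).2.trans (min_le_right _ _)))

/-- a modulus grade anchors `β` at `b` (the identification currency). [folklore] -/
theorem anchor_of_boxModulus {ω : ℝ → ℝ} {γ₀ : ℝ} (h : BoxModulus β b ω γ₀) (hω : VanishesAtZero ω) (hγ₀ : 0 < γ₀) : Anchor β b := by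
  intro k δ hδ
  obtain ⟨γ₁, hγ₁, -, hb⟩ := const_of_boxModulus h hω hγ₀ hδ
  exact ⟨γ₁, hγ₁, fun p hp => hb k p hp⟩

end Generic

/-! ## §2 Structural: the one-loop numbers of EVERY split of a β of record are the record's `β0` -/

/-- **Every `OneLoopSplit` of `betaOfMerged βm β0 γ` has `S.β0 = β0`** (evaluate `split` ∕ `vanish` at the zero history, which is OFF the box where the β of record IS `β0`).
Consequence: a line typed through `OneLoopSplit`-consumers of a record's β (idea-7's line 2: `RemainderShiftRate S`, `AnchorVanishing S`, `EverySlope S`,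
`D1Residue.endpointExistence_of_residue … S …`) reads the record's `β0 := beta0OfMerged … θ.v₀` WHATEVER split it names. [folklore] -/
theorem split_β0_eq {βm : HBeta} {β0 : ℕ → ℝ} {γ : ℝ} (S : OneLoopSplit (betaOfMerged βm β0 γ)) : S.β0 = β0 := by
  funext k
  have h0 : (fun _ : Fin (k + 1) => (0 : ℝ)) ∉ Box γ k := fun hmem => lt_irrefl (0 : ℝ) ((mem_box.mp hmem) (Fin.last k)).1
  have hs := S.split k (fun _ => 0)
  rw [S.vanish k _ rfl, add_zero, betaOfMerged_of_notMem _ _ _ h0] at hs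
  exact hs.symm

/-! ## §3 At NODE 00's Stage-13 record (`N = 2`, v1.7 `H` Sep-Co-PH provisos) -/

section AtRecord

variable (F : T4Family) (κ : StepColourData) (θ : Node00.Stage13HParams F 2) (hP : θ.Provisos₁₃SepCoPH F 2)

/-- the datum's β IS the record's `betaOfMerged … (beta0OfMerged … θ.v₀) θ.γ` (`rfl`; `Node00.βfun_datumOfRecord₁₃SepCoPH`). [bookkeeping] -/
theorem βfun_eq :
    letI := θ.instVβ₁; letI := θ.instVβ₂; letI := θ.instιβ
    (Node00.datumOfRecord₁₃SepCoPH F 2 θ hP).βfun =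
      betaOfMerged (betaMerged F (mergedTermFamilyMatT F 2 (TcanOfRecord F 2) (chiFixed29 F 2 θ.ν θ.ε₂₉) θ.εbg) θ.ρ8 θ.bV)
        (beta0OfMerged (betaMerged F (mergedTermFamilyMatT F 2 (TcanOfRecord F 2) (chiFixed29 F 2 θ.ν θ.ε₂₉) θ.εbg) θ.ρ8 θ.bV) θ.v₀) θ.γ := rfl

/-- **(P2★, structural) EVERY one-loop split of the datum's β has one-loop numbers `beta0OfMerged … θ.v₀`** — the `θ.v₀`-path `limUnder` numbers
(`Node00/BetaOfRecord.lean` :192), `θ.v₀` being a free field of `Stage8Params` that NO admissibility clause reads (CRIT-1 F1a). [bookkeeping] -/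
theorem split_β0_eq_beta0OfMerged (S : OneLoopSplit (Node00.datumOfRecord₁₃SepCoPH F 2 θ hP).βfun) :
    letI := θ.instVβ₁; letI := θ.instVβ₂; letI := θ.instιβ
    S.β0 = beta0OfMerged (betaMerged F (mergedTermFamilyMatT F 2 (TcanOfRecord F 2) (chiFixed29 F 2 θ.ν θ.ε₂₉) θ.εbg) θ.ρ8 θ.bV) θ.v₀ :=
  split_β0_eq S

/-- **idea-5 LOCATED-A (v3): the body of idea-5's `AF1AtRecord13` at θ ⟺ stub 2′'s `BoxRemainder` conjunct AT THE RECORD's numbers `beta0OfMerged … θ.v₀`**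
(same `C`, same box) — so idea-5's Tier-1 currency IS a conjunct of a registered stub, up to the REFERENCE numbers (record's `θ.v₀`-path numbers vs the named `beta0OfJs F κ`).
[bookkeeping] -/
theorem af1AtRecord_iff_boxRemainder (C γ₀ : ℝ) :
    letI := θ.instVβ₁; letI := θ.instVβ₂; letI := θ.instιβ
    (∀ (k : ℕ) (p : Fin (k + 1) → ℝ), p ∈ HistBox γ₀ k →
      |(oneLoopSplit_betaOfMerged
          (betaMerged F (mergedTermFamilyMatT F 2 (TcanOfRecord F 2) (chiFixed29 F 2 θ.ν θ.ε₂₉) θ.εbg) θ.ρ8 θ.bV)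
          (beta0OfMerged (betaMerged F (mergedTermFamilyMatT F 2 (TcanOfRecord F 2) (chiFixed29 F 2 θ.ν θ.ε₂₉) θ.εbg) θ.ρ8 θ.bV) θ.v₀)
          θ.γ).β1 k p| ≤ C * p (Fin.last k)) ↔
    BoxRemainder (Node00.datumOfRecord₁₃SepCoPH F 2 θ hP).βfun
      (beta0OfMerged (betaMerged F (mergedTermFamilyMatT F 2 (TcanOfRecord F 2) (chiFixed29 F 2 θ.ν θ.ε₂₉) θ.εbg) θ.ρ8 θ.bV) θ.v₀) C γ₀ :=
  af1_iff_boxRemainder _ C γ₀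

/-- **idea-5 LOCATED-B (v3), SEAM FREE: (AF-1) at the NAMED numbers on some box + (C) + (U) on some box ⟹ `RemAt F κ θ hP`** — the seam conjunct
`C_r·γ₀ ≤ stepBal 2 F.L` of stub 2′ costs nothing for the linear form (`0 < stepBal 2 F.L`, shrink the box).  So idea-5's engine output RE-REFERENCED to `beta0OfJs F κ`
with its (C)∕(U) by-products DISCHARGES stub 2′ at (κ, θ); what it does NOT supply is the reference (the identification ∕ (P6) κ, owned elsewhere). [bookkeeping] -/
theorem remAt_of_boxRemainder_cont_up {C γ₀ γc β' : ℝ}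
    (hrem : BoxRemainder (Node00.datumOfRecord₁₃SepCoPH F 2 θ hP).βfun (beta0OfJs F κ) C γ₀) (hC : 0 ≤ C) (hγ₀ : 0 < γ₀) (hγ₀θ : γ₀ ≤ θ.γ)
    (hγc : 0 < γc) (hcont : BetaContH γc (Node00.datumOfRecord₁₃SepCoPH F 2 θ hP).βfun)
    (hβ' : 0 ≤ β') (hup : BetaUpperH β' γc (Node00.datumOfRecord₁₃SepCoPH F 2 θ hP).βfun) :
    RemAt F κ θ hP := by
  obtain ⟨γ₁, hγ₁, hγ₁le, hrem₁, hseam⟩ := boxRemainder_seam_free hrem hC hγ₀ (stepBal_L_pos F (N := 2) (by norm_num))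
  refine ⟨min γ₁ γc, C, β', lt_min hγ₁ hγc, (min_le_left _ _).trans (hγ₁le.trans hγ₀θ), hC, hβ', hrem₁.mono (min_le_left _ _), ?_,
    fun k => (hcont k).mono (box_mono (min_le_right _ _) k), fun k v hv => hup k v (box_mono (min_le_right _ _) k hv)⟩
  exact (mul_le_mul_of_nonneg_left (min_le_left _ _) hC).trans hseam

/-- **idea-5 at the MODULUS grade (g0's type note: the convex-fibre engine delivers `ω(g) = C·g·log⁶(C′∕g)`, not a linear bound) ⟹ an4's CONSTANT-FORM package `RemAtC`
(shape VERBATIM from p590583 `remAtC_of_remAt`'s conclusion), SEAM FREE** — `s := stepBal 2 F.L` itself, box shrunk; the anchor (identification currency) comes with it.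
[bookkeeping] -/
theorem remAtC_of_boxModulus_cont_up {ω : ℝ → ℝ} {γ₀ γc β' : ℝ}
    (hrem : BoxModulus (Node00.datumOfRecord₁₃SepCoPH F 2 θ hP).βfun (beta0OfJs F κ) ω γ₀) (hω : VanishesAtZero ω) (hγ₀ : 0 < γ₀) (hγ₀θ : γ₀ ≤ θ.γ)
    (hγc : 0 < γc) (hcont : BetaContH γc (Node00.datumOfRecord₁₃SepCoPH F 2 θ hP).βfun)
    (hβ' : 0 ≤ β') (hup : BetaUpperH β' γc (Node00.datumOfRecord₁₃SepCoPH F 2 θ hP).βfun) :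
    ∃ γ₀ s β' : ℝ, 0 < γ₀ ∧ γ₀ ≤ θ.γ ∧ 0 ≤ s ∧ s ≤ B12Normalization.stepBal 2 F.L ∧ 0 ≤ β' ∧
      (∀ (k : ℕ) (p : Fin (k + 1) → ℝ), p ∈ HistBox γ₀ k → |(Node00.datumOfRecord₁₃SepCoPH F 2 θ hP).βfun k p - beta0OfJs F κ k| ≤ s) ∧
      (∀ (k : ℕ) (δ : ℝ), 0 < δ → ∃ γ : ℝ, 0 < γ ∧ ∀ p : Fin (k + 1) → ℝ, p ∈ HistBox γ k →
        |(Node00.datumOfRecord₁₃SepCoPH F 2 θ hP).βfun k p - beta0OfJs F κ k| ≤ δ) ∧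
      BetaContH γ₀ (Node00.datumOfRecord₁₃SepCoPH F 2 θ hP).βfun ∧
      BetaUpperH β' γ₀ (Node00.datumOfRecord₁₃SepCoPH F 2 θ hP).βfun := by
  have hsB : 0 < B12Normalization.stepBal 2 (F.L : ℝ) := stepBal_L_pos F (N := 2) (by norm_num)
  obtain ⟨γ₁, hγ₁, hγ₁le, hb⟩ := const_of_boxModulus hrem hω hγ₀ hsB
  refine ⟨min γ₁ γc, B12Normalization.stepBal 2 F.L, β', lt_min hγ₁ hγc, (min_le_left _ _).trans (hγ₁le.trans hγ₀θ), hsB.le, le_rfl, hβ',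
    fun k p hp => hb k p (fun i => ⟨(hp i).1, (hp i).2.trans (min_le_left _ _)⟩), anchor_of_boxModulus hrem hω hγ₀,
    fun k => (hcont k).mono (box_mono (min_le_right _ _) k), fun k v hv => hup k v (box_mono (min_le_right _ _) k hv)⟩

/-- **idea-7 S2′ «anchor at the NAMED numbers» IS FREE GIVEN stub 2′ at (κ, θ)** (an4's `anchor_of_boxRemainder`). [bookkeeping] -/
theorem anchorNamed_of_remAt (h : RemAt F κ θ hP) : Anchor (Node00.datumOfRecord₁₃SepCoPH F 2 θ hP).βfun (beta0OfJs F κ) := by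
  obtain ⟨γ₀, Cr, β', hγ₀, -, hCr, -, hrem, -, -, -⟩ := h
  exact anchor_of_boxRemainder hrem hCr hγ₀

/-- **(P2★) idea-7's S2 AT θ, UNDER line 1′'s stub 2′ AT (κ, θ), IS EXACTLY THE IDENTIFICATION of the record's `θ.v₀`-path `limUnder` numbers with the named ones**:
`AnchorVanishing (record split at θ) ↔ beta0OfMerged … θ.v₀ = beta0OfJs F κ`.  S2 is therefore NOT a by-product of line 1′; its residual content relative to
stub 2′ is the `v₀`-REFERENCE identification and nothing else. [bookkeeping] -/
theorem anchor13_iff_ident_of_remAt (h : RemAt F κ θ hP) :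
    letI := θ.instVβ₁; letI := θ.instVβ₂; letI := θ.instιβ
    AnchorVanishing
        (oneLoopSplit_betaOfMerged (betaMerged F (mergedTermFamilyMatT F 2 (TcanOfRecord F 2) (chiFixed29 F 2 θ.ν θ.ε₂₉) θ.εbg) θ.ρ8 θ.bV)
          (beta0OfMerged (betaMerged F (mergedTermFamilyMatT F 2 (TcanOfRecord F 2) (chiFixed29 F 2 θ.ν θ.ε₂₉) θ.εbg) θ.ρ8 θ.bV) θ.v₀) θ.γ) ↔
      beta0OfMerged (betaMerged F (mergedTermFamilyMatT F 2 (TcanOfRecord F 2) (chiFixed29 F 2 θ.ν θ.ε₂₉) θ.εbg) θ.ρ8 θ.bV) θ.v₀ = beta0OfJs F κ := by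
  obtain ⟨γ₀, Cr, β', hγ₀, -, hCr, -, hrem, -, -, -⟩ := h
  rw [anchorVanishing_iff_anchor]
  exact anchor_iff_eq_of_boxRemainder hrem hCr hγ₀

/-- **(P2★, any split) a line-2-type anchor for ANY split `S` of the datum's β, at a tuple where stub 2′ holds for κ, PROVES `beta0OfMerged … θ.v₀ = beta0OfJs F κ`.**
[bookkeeping] -/
theorem ident_of_anchorVanishing_remAt (S : OneLoopSplit (Node00.datumOfRecord₁₃SepCoPH F 2 θ hP).βfun) (hA : AnchorVanishing S) (h : RemAt F κ θ hP) :
    letI := θ.instVβ₁; letI := θ.instVβ₂; letI := θ.instιβ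
    beta0OfMerged (betaMerged F (mergedTermFamilyMatT F 2 (TcanOfRecord F 2) (chiFixed29 F 2 θ.ν θ.ε₂₉) θ.εbg) θ.ρ8 θ.bV) θ.v₀ = beta0OfJs F κ := by
  obtain ⟨γ₀, Cr, β', hγ₀, -, hCr, -, hrem, -, -, -⟩ := h
  rw [← split_β0_eq_beta0OfMerged F θ hP S]
  exact (anchor_iff_eq_of_boxRemainder hrem hCr hγ₀).mp ((anchorVanishing_iff_anchor S).mp hA)

end AtRecord

/-- **★ CROSS-LINE CONSEQUENCE (v3's two registered (D4)-side stubs together): {`stub_anchor13 : D4AnchorRecord13`, `stub_remNamedJets13 : RemAtSomeJets`} ⊢ for every family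
SOME colour datum κ whose named one-loop numbers EQUAL the record's `θ.v₀`-path `limUnder` numbers AT EVERY ADMISSIBLE TUPLE — `θ.v₀` UNCONSTRAINED** (`Stage8Params.v₀` is read by
no `Admissible` clause, CRIT-1 F1a; the records of record set `v₀ := 0`, F1b, so the path `(0,…,0,g)` runs along the zero edge OUTSIDE every box).  This is the `v₀` data anomaly
v3 removed from line 1 — line 2's S2 (and its (D1)-pin `D1AtRecord13Pos`) still carry it. [bookkeeping] -/
theorem ident_everywhere_of_anchor13_remAtSomeJets (hA : D4AnchorRecord13) (hR : RemAtSomeJets) :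
    ∀ F : T4Family, ∃ κ : StepColourData, ∀ (θ : Node00.Stage13HParams F 2) (hP : θ.Provisos₁₃SepCoPH F 2), θ.Admissible F 2 →
      letI := θ.instVβ₁; letI := θ.instVβ₂; letI := θ.instιβ
      beta0OfMerged (betaMerged F (mergedTermFamilyMatT F 2 (TcanOfRecord F 2) (chiFixed29 F 2 θ.ν θ.ε₂₉) θ.εbg) θ.ρ8 θ.bV) θ.v₀ = beta0OfJs F κ := by
  intro F
  obtain ⟨κ, hκ⟩ := hR F
  exact ⟨κ, fun θ hP hθ => (anchor13_iff_ident_of_remAt F κ θ hP (hκ θ hP hθ)).mp (hA F θ hP hθ)⟩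

end Summit.QuantumFields.YangMills.Cruxes.EndpointGivenBR13SepCoPH.Crit2RepriceV3

end
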